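import Summits.BirchSwinnertonDyer.BirchSwinnertonDyer.Theorems.SignedLowerHalvesSmallImageLowerHalfBothSignsRttJunctionShaLocCountOffP
import HarnessLib

/-!
# Route `SignedLowerHalves`, crux L `SmallImageLowerHalfBothSigns` (stmt-BirchSwinnertonDyer-23599), line `rtt_w3` v30 — stub S3α′ (`stub_junctionShaPT_ns`),
# brick α2-lev (part 4): THE PLACE ABOVE `p` — the levelwise uniform bound from ONE element `τ ∈ Gal(K̄_v / K_v·K_∞·(μ_{p^∞}))` with `θ′(τ) ≠ 1` (the height-two / Imai-type input, ISOLATED)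

INPUTS hand `bsd-inputs-honda-p1` g28 under LEAD `cruxlead-stmt-BirchSwinnertonDyer-23599` g14 (cell `bsd-ssimc`); helper `--supports stmt-BirchSwinnertonDyer-23599`. THEOREMS ONLY.
WHAT. Part 2 bounds `#H²(Γ_{K_w}, Maps(Γ_K ⧸ U_n, X_k))` uniformly from `τ, σ ∈ Γ_{K_w}`; part 3 discharges both away from `p`. At a place `v ∣ p` NON-SPLIT in the tower (`IsNonsplitIn κ v`, tree
`isNonsplitIn_restrictOfFinrankEqTwo` at the inert `vp`) `σ` is free; this file reduces the `τ`-data to its mathematical core: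
* `exists_pow_eq_mul_of_ne_zero` — every `a ≠ 0` of `𝒪 = 𝒪_{ℚ_p(S)}` divides a power of `p` (`[ℚ_p(S):ℚ_p] < ∞` not even needed: `‖p^m‖ → 0`);
* `mu_resGalOfEmb_eq_self_of_forall_mu_eq_self` — if `τ ∈ Γ_{K_v}` fixes `μ_{p^k}(K̄_v)` then `res τ` fixes `μ_{p^k}(K̄)` (the chosen embedding `K̄ → K̄_v`);
  `muTwistO_resGalOfEmb_eq_oMuScalar` — then `res τ` acts on `𝒪 ⊗ μ_{p^k} ⊗ θ′` as the scalar `θ′(res τ)`;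
* ★★★ `exists_bound_semilocCoh_two_of_apply_ne_one` — at a non-split `v`: ONE `τ ∈ Γ_{K_v}` lying over `K_∞` (`res τ ∈ U_n ∀ n`), fixing `μ_{p^∞}(K̄_v)`, with `θ′(res τ) ≠ 1`, gives
  `∀ n k, Finite ∧ Nat.card ≤ B` for the degree-2 semilocal levels at `v`. THIS HYPOTHESIS («`θ′` non-trivial on `Gal(K̄_v/K_v K_∞(μ_{p^∞}))`») is the height-two / Imai-type input of S3α′
  at `vp` (for the CM curve: the `p`-adic character of `E[p^∞]|_{Γ_{K_v}}` is Lubin–Tate of `𝒪_{K_v}`-height one, so its restriction to the cyclotomic kernel is infinite; equivalently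
  `E(K_v(μ_{p^∞}))[p^∞]` is finite, Imai 1975) — it is NOT a consequence of `CharRoadFrameProps`/`CharRoadFrameSupp` and is displayed, not proved.
HONEST FRAMING: nothing about S3α′, E2, crux L or BSD is proved; all remain OPEN and are proved for NO curve.
References: [Imai1975] Theorem (p. 12); [deShalit1987] II §1; [PerrinRiou1994Invent] §1.3; [NeukirchSchmidtWingberg2008] (8.6.2)–(8.6.3).
-/

set_option autoImplicit false
set_option linter.dupNamespace false -- D-0017: single-problem summit, the namespace repeats the problem name by design
noncomputable section

open scoped Classical
open NumberField IsDedekindDomain Field CategoryTheory Function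

namespace Summit.BirchSwinnertonDyer.BirchSwinnertonDyer.Theorems.SmallImageRttJunctionSha

open Literature.NumberTheory.EllipticCurves Literature.NumberTheory.GaloisRepresentations Literature.NumberTheory.GaloisRepresentations.DiscreteGaloisModule
  Literature.NumberTheory.ComplexMultiplication.EllipticUnits.JohnsonLeungKings2011
  Summit.BirchSwinnertonDyer.BirchSwinnertonDyer.Theorems.SmallImageRttD2J1
  Summit.BirchSwinnertonDyer.BirchSwinnertonDyer.Theorems.SmallImageRttD2Seq

section AtP

variable {K : Type} [Field K] [NumberField K] {p : ℕ} [Fact p.Prime] (S : Set (PadicAlgCl p))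
  (κ : ZpExtension K p) (θ' : absoluteGaloisGroup K →ₜ* (padicCoeffIntegers S)ˣ) (P : Set (HeightOneSpectrum (𝓞 K))) (w : HeightOneSpectrum (𝓞 K))

omit [NumberField K] in
/-- **Every non-zero `a ∈ 𝒪 = 𝒪_{ℚ_p(S)}` divides a power of `p`** (`‖p^m‖ = ‖p‖^m → 0`, so `‖p^m‖ ≤ ‖a‖` for some `m`, and then `p^m / a ∈ ℚ_p(S)` has norm `≤ 1`). [folklore] -/
theorem exists_pow_eq_mul_of_ne_zero (a : padicCoeffIntegers S) (ha : a ≠ 0) : ∃ (m : ℕ) (b : padicCoeffIntegers S), ((p : ℕ) : padicCoeffIntegers S) ^ m = a * b := by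
  have ha' : (a : PadicAlgCl p) ≠ 0 := fun h ↦ ha (Subtype.ext h)
  have hpos : 0 < ‖(a : PadicAlgCl p)‖ := norm_pos_iff.mpr ha'
  have hp1 : ‖(p : PadicAlgCl p)‖ < 1 := by
    rw [← map_natCast (algebraMap ℚ_[p] (PadicAlgCl p)) p, PadicAlgCl.norm_extends]
    exact Padic.norm_p_lt_one
  obtain ⟨m, hm⟩ := exists_pow_lt_of_lt_one hpos hp1
  refine ⟨m, ⟨(p : PadicAlgCl p) ^ m / (a : PadicAlgCl p), ⟨?_, ?_⟩⟩, ?_⟩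
  · exact div_mem (pow_mem (IntermediateField.natCast_mem _ p) m) a.2.1
  · rw [norm_div, norm_pow]
    exact div_le_one_of_le₀ hm.le (norm_nonneg _)
  · apply Subtype.ext
    change ((p : PadicAlgCl p)) ^ m = (a : PadicAlgCl p) * ((p : PadicAlgCl p) ^ m / (a : PadicAlgCl p))
    rw [mul_div_cancel₀ _ ha']

/-- **If `τ ∈ Γ_{K_w}` fixes the `p^k`-th roots of unity of `K̄_w`, then `res τ` fixes those of `K̄`** (through the chosen embedding `ι : K̄ → K̄_w`: `ι((res τ) ζ) = τ(ι ζ)` and `ι ζ` is a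
`p^k`-th root of unity of `K̄_w`). [cite: NeukirchANT1999, II §9 Prop. (9.6)] [folklore] -/
theorem mu_resGalOfEmb_eq_self_of_forall_mu_eq_self (k : ℕ) {τ : absoluteGaloisGroup (w.adicCompletion K)}
    (hτ : ∀ ζ : MuCarrier (w.adicCompletion K) (p ^ k), mu (w.adicCompletion K) (p ^ k) τ ζ = ζ) (v : MuCarrier K (p ^ k)) :
    mu K (p ^ k) (resGalOfEmb (closureEmb (K := K) (w.adicCompletion K)) τ) v = v := by
  haveI : NeZero (p ^ k) := ⟨pow_ne_zero _ (Fact.out : p.Prime).ne_zero⟩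
  apply muVal_injective K (p ^ k)
  rw [muVal_apply]
  ext
  rw [Units.coe_smul]
  set ι := closureEmb (K := K) (w.adicCompletion K) with hι
  -- `ι ζ` is a `p^k`-th root of unity of `K̄_w`, hence fixed by `τ`
  have hζ : (ι ((muVal K (p ^ k) v : (AlgebraicClosure K)ˣ) : AlgebraicClosure K)) ^ p ^ k = 1 := by
    rw [← map_pow, ← Units.val_pow_eq_pow_val, muVal_pow_eq_one, Units.val_one, map_one]
  have hfix := hτ (MuCarrier.ofRootsOfUnity (rootsOfUnity.mkOfPowEq _ hζ))
  have hfix' : τ • (ι ((muVal K (p ^ k) v : (AlgebraicClosure K)ˣ) : AlgebraicClosure K)) = ι ((muVal K (p ^ k) v : (AlgebraicClosure K)ˣ) : AlgebraicClosure K) := by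
    have h := congrArg (fun z ↦ ((muVal (w.adicCompletion K) (p ^ k) z : (AlgebraicClosure (w.adicCompletion K))ˣ) : AlgebraicClosure (w.adicCompletion K))) hfix
    simp only [muVal_apply, muVal_ofRootsOfUnity, Units.coe_smul, rootsOfUnity.val_mkOfPowEq_coe] at h
    exact h
  have h' : ι ((resGalOfEmb ι τ) • ((muVal K (p ^ k) v : (AlgebraicClosure K)ˣ) : AlgebraicClosure K)) = ι ((muVal K (p ^ k) v : (AlgebraicClosure K)ˣ) : AlgebraicClosure K) := by
    rw [resGalOfEmb_apply]
    exact (apply_resGalAuxOfEmb_apply ι τ _).trans hfix'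
  exact ι.injective h'

/-- **Then `res τ` acts on `𝒪 ⊗ μ_{p^k}(K̄) ⊗ θ′` as the scalar `θ′(res τ)`** (`σ·(a ⊗ ζ) = θ′(σ)a ⊗ σζ`). [cite: JohnsonLeungKings2011, Def. 1.1, §4.2] -/
theorem muTwistO_resGalOfEmb_eq_oMuScalar (k : ℕ) {τ : absoluteGaloisGroup (w.adicCompletion K)}
    (hτ : ∀ ζ : MuCarrier (w.adicCompletion K) (p ^ k), mu (w.adicCompletion K) (p ^ k) τ ζ = ζ) (x : OMuCarrier K S (p ^ k)) :
    muTwistO S θ' k (resGalOfEmb (closureEmb (K := K) (w.adicCompletion K)) τ) x =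
      oMuScalar S (p ^ k) ((θ' (resGalOfEmb (closureEmb (K := K) (w.adicCompletion K)) τ) : (padicCoeffIntegers S)ˣ) : padicCoeffIntegers S) x := by
  induction x using OMuCarrier.induction_on with
  | zero => rw [map_zero, map_zero]
  | tmul a v => rw [muTwistO_tmul, oMuScalar_tmul, mu_resGalOfEmb_eq_self_of_forall_mu_eq_self w k hτ]
  | add x y hx hy => rw [map_add, map_add, hx, hy]

variable [FiniteDimensional ℚ_[p] (padicCoeffField S)]

/-- ★★★ **THE PLACE ABOVE `p`: the levelwise uniform bound from ONE `τ ∈ Gal(K̄_v / K_v·K_∞·(μ_{p^∞}))` with `θ′(τ) ≠ 1`.** At a place `v` NON-SPLIT in the tower (`κ ∘ res_v` onto; the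
inert `vp`: tree `isNonsplitIn_restrictOfFinrankEqTwo`), if some `τ ∈ Γ_{K_v}` lies in every layer group (`res τ ∈ U_n`), fixes all `p`-power roots of unity of `K̄_v`, and `θ′(res τ) ≠ 1`,
then every `H²(Γ_{K_v}, Maps(Γ_K ⧸ U_n, X_k))` is finite with cardinality bounded independently of `n, k`. The hypothesis is the height-two / Imai-type input (Lubin–Tate character of the
CM curve at the inert prime; `E(K_v(μ_{p^∞}))[p^∞]` finite), NOT supplied by the frame. [cite: Imai1975, Theorem (p. 12)] [cite: deShalit1987, II §1] [cite: PerrinRiou1994Invent, §1.3] -/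
theorem exists_bound_semilocCoh_two_of_apply_ne_one (hv : AcSigned.IsNonsplitIn κ w) {τ : absoluteGaloisGroup (w.adicCompletion K)}
    (hτU : ∀ n, resGalOfEmb (closureEmb (K := K) (w.adicCompletion K)) τ ∈ κ.layerSubgroup n)
    (hτμ : ∀ (k : ℕ) (ζ : MuCarrier (w.adicCompletion K) (p ^ k)), mu (w.adicCompletion K) (p ^ k) τ ζ = ζ)
    (hτθ : θ' (resGalOfEmb (closureEmb (K := K) (w.adicCompletion K)) τ) ≠ 1) :
    (∀ n k, Finite (semilocCoh S κ θ' P w n k 2)) ∧ ∃ B : ℕ, ∀ n k, Nat.card (semilocCoh S κ θ' P w n k 2) ≤ B := by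
  set u : padicCoeffIntegers S := ((θ' (resGalOfEmb (closureEmb (K := K) (w.adicCompletion K)) τ) : (padicCoeffIntegers S)ˣ) : padicCoeffIntegers S) with hu
  have hu1 : u - 1 ≠ 0 := fun h ↦ hτθ (Units.ext (by rw [← hu, Units.val_one]; exact sub_eq_zero.mp h))
  obtain ⟨m, b, hmb⟩ := exists_pow_eq_mul_of_ne_zero S (u - 1) hu1
  exact exists_bound_semilocCoh_two_of_isNonsplitIn S κ θ' P w hv hτU hτμ (fun k x ↦ muTwistO_resGalOfEmb_eq_oMuScalar S θ' w k (hτμ k) x) (Dvd.intro b hmb.symm)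

end AtP

end Summit.BirchSwinnertonDyer.BirchSwinnertonDyer.Theorems.SmallImageRttJunctionSha

end
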